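import Summits.RiemannHypothesis.RiemannHypothesis.Theses.AngularHeatFlow

/-!
# Birth skeleton — crux `AhfHighReal` (stmt-RiemannHypothesis-10532), route `AngularHeatFlow`

Crux (route decl, verbatim): for every `c > 0`, every zero `z` of the Gaussian-tapered series
`T_c G(z) = ∑' n, e^{-c n²} · (xiTaylorCoeff n / (8·n!)) · zⁿ` with `‖z‖ ≥ 4/c` is real.

Skeleton (three registered stubs, composition `AhfHighReal_of` proved below):

* `stub_farSector` — A-PRIORI GRADED SECTOR in the far regime: a zero with `‖z‖ ≥ 4/c`,
  `‖z‖ ≥ 10⁶` and `u₀ := (c‖z‖/4)·log(√‖z‖/(2π)) ≥ 20` lies in the negative parabolic sector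
  `re z < 0`, `|im z| ≤ 2√‖z‖` (the image of the closed critical strip under `ρ ↦ (ρ − 1/2)²`
  has `|im| < √‖z‖`; factor 2 of slack). Role: the input that `Polymath15.abs_im_lt_one_of_zero`
  plays in the tree's Hermite–Biehler reduction `ki_kim_lee_finite_of_strictMonoOn_xiHeatRay`;
  engine: two-sided Laplace comparison of the rotation average
  `T_c G(w²) = E_α[ξ(1/2 + w e^{iα})]`, `α ∼ N(0, c/2)` (effective de Bruijn time `t_eff = c‖z‖ ≥ 4`),
  or a multiplicative de Bruijn non-widening lemma.
* `stub_farReal` — GRADED FAR-FIELD REALITY (the engine): in the same regime, a zero lying in that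
  sector is real. Transplant of the in-tree Ki–Kim–Lee proof (`XiHeatRayLaplace`,
  `XiHeatRayMonotone`: `u₀ = tℓ/2 ≥ 20`, `T ≥ 1000`) to the ANGULAR ray: with `T = √‖z‖`,
  `t_eff = c‖z‖`, `ℓ = ½ log(T/2π)` the tree's regime condition reads exactly
  `(c‖z‖/4)·log(√‖z‖/(2π)) ≥ 20`, `‖z‖ ≥ 10⁶`; Hermite–Biehler in the angle: a zero `w² = z`,
  `w = T e^{i(π/2−φ)}`, forces `|𝓑_c(T e^{i(π/2−φ)})| = |𝓑_c(T e^{i(π/2+φ)})|` for the one-sided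
  angular ray `𝓑_c`, contradicting strict monotonicity in `φ` on the a-priori range unless `φ = 0`.
  The regime also contains the crossover (saddle angle `O(1)`) and the theta-comparison tail
  (`AhfTailFinite`'s engine); provers may split by `--supports`.
* `stub_window` — RESIDUAL BOUNDED WINDOW: zeros with `4/c ≤ ‖z‖` but `‖z‖ < 10⁶` or `u₀ < 20`
  are real. Empty for `c ≤ e^{-40}/π²`; otherwise a bounded window whose height `√‖z‖` never
  exceeds `2π e^{20} ≈ 3.05·10⁹ < 3·10¹²` (Platt–Trudgian), so it is RH-to-height transported
  along the monotone flow (`AhfMonotone`) plus a certified count, and for `c ≥ log 2` it is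
  `AhfRungZero` (Hutchinson).

Shape (tree convention, cf. `Cruxes/LogCombLandingLaw/Lines/birth.lean`): the three statements are
named propositions `Sig.stub_*` (same short names as the registered stubs, so the skeleton audit admits
them as hypotheses); the registered stubs `stub_*` spell the signatures out verbatim (`sorry` lives
ONLY there); `AhfHighReal_of (hS : Sig.stub_farSector) (hF : Sig.stub_farReal) (hW : Sig.stub_window) :
AhfHighReal` is the sorry-free composition (case split on the far-regime predicate), and
`AhfHighReal_proof : AhfHighReal := AhfHighReal_of stub_farSector stub_farReal stub_window` is the
skeleton theorem concluding the crux BY NAME.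
-/

namespace Summit.RiemannHypothesis.RiemannHypothesis.Cruxes.AhfHighReal.Birth

open Summit.RiemannHypothesis.RiemannHypothesis.Theses.AngularHeatFlow (AhfHighReal AhfTailFinite)

/-! ## The three stub statements as named propositions `Sig.stub_*` -/

namespace Sig

/-- **Stub 1 (A-PRIORI GRADED SECTOR, far regime).** For `c > 0` and a zero `z` of `T_c G` with
`4/c ≤ ‖z‖`, `10⁶ ≤ ‖z‖` and `20 ≤ (c‖z‖/4)·log(√‖z‖/(2π))`: `re z < 0` and `|im z| ≤ 2 √‖z‖`.
RH-implied (then every zero is a negative real); as an unconditional theorem it is the angular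
analogue of de Bruijn's strip bound for `H_t` (`Polymath15.abs_im_lt_one_of_zero`: the input of the
Hermite–Biehler reduction), via the two-sided Laplace comparison of `E_α[ξ(1/2 + √z · e^{iα})]`
or a multiplicative non-widening lemma. Size: L. -/
def stub_farSector : Prop :=
  ∀ c : ℝ, 0 < c → ∀ z : ℂ,
      (∑' n : ℕ, (Real.exp (-(c * (n : ℝ) ^ 2)) : ℂ) *
        ((Literature.NumberTheory.LFunctions.xiTaylorCoeff n : ℂ) / (8 * (n.factorial : ℂ))) *
          z ^ n) = 0 →
      4 / c ≤ ‖z‖ → (10 : ℝ) ^ 6 ≤ ‖z‖ →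
      20 ≤ c * ‖z‖ / 4 * Real.log (Real.sqrt ‖z‖ / (2 * Real.pi)) →
      z.re < 0 ∧ |z.im| ≤ 2 * Real.sqrt ‖z‖

/-- **Stub 2 (GRADED FAR-FIELD REALITY — the Ki–Kim–Lee transplant).** For `c > 0` and a zero `z`
of `T_c G` with `4/c ≤ ‖z‖`, `10⁶ ≤ ‖z‖`, `20 ≤ (c‖z‖/4)·log(√‖z‖/(2π))`, lying in the sector
`re z < 0`, `|im z| ≤ 2√‖z‖`: `z` is real. Mechanism: rotation identity
`T_c G(w²) = E_α[ξ(1/2 + w e^{iα})]`, `α ∼ N(0,c/2)` (effective heat time `c‖z‖ ≥ 4`), fold to the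
one-sided angular ray `𝓑_c`, Hermite–Biehler in the angle, strict monotonicity of
`φ ↦ |𝓑_c(√‖z‖ e^{i(π/2+φ)})|` by Laplace's method (`XiHeatRayLaplace`/`XiHeatRayMonotone`
analogues; regime constants are theirs: `u₀ ≥ 20`, `T ≥ 1000`); the regime also contains the
crossover (saddle angle `O(1)`) and the theta-comparison tail. RH-implied; unconditional theorem
target. Size: XL. -/
def stub_farReal : Prop :=
  ∀ c : ℝ, 0 < c → ∀ z : ℂ,
      (∑' n : ℕ, (Real.exp (-(c * (n : ℝ) ^ 2)) : ℂ) *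
        ((Literature.NumberTheory.LFunctions.xiTaylorCoeff n : ℂ) / (8 * (n.factorial : ℂ))) *
          z ^ n) = 0 →
      4 / c ≤ ‖z‖ → (10 : ℝ) ^ 6 ≤ ‖z‖ →
      20 ≤ c * ‖z‖ / 4 * Real.log (Real.sqrt ‖z‖ / (2 * Real.pi)) →
      (z.re < 0 ∧ |z.im| ≤ 2 * Real.sqrt ‖z‖) → z.im = 0

/-- **Stub 3 (RESIDUAL BOUNDED WINDOW).** For `c > 0` and a zero `z` of `T_c G` with `4/c ≤ ‖z‖`
that is NOT in the far regime (`‖z‖ < 10⁶` or `(c‖z‖/4)·log(√‖z‖/(2π)) < 20`): `z` is real.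
Vacuous for `c ≤ e^{-40}/π²`; otherwise the window is bounded with height
`√‖z‖ ≤ 2π e^{20} ≈ 3.05·10⁹`, inside RH verified to `3·10¹²` (PlattTrudgian2021), to be
transported along the monotone flow (`AhfMonotone`) with a certified count; for `c ≥ log 2` it is
`AhfRungZero` (Hutchinson). RH-implied. Size: L. -/
def stub_window : Prop :=
  ∀ c : ℝ, 0 < c → ∀ z : ℂ,
      (∑' n : ℕ, (Real.exp (-(c * (n : ℝ) ^ 2)) : ℂ) *
        ((Literature.NumberTheory.LFunctions.xiTaylorCoeff n : ℂ) / (8 * (n.factorial : ℂ))) *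
          z ^ n) = 0 →
      4 / c ≤ ‖z‖ →
      (‖z‖ < (10 : ℝ) ^ 6 ∨ c * ‖z‖ / 4 * Real.log (Real.sqrt ‖z‖ / (2 * Real.pi)) < 20) →
      z.im = 0

end Sig

/-! ## The registered stubs (full signatures spelled out verbatim; `sorry` lives only here) -/

/-- Registered stub `stub_farSector` (= `Sig.stub_farSector`, spelled out so that a `Theorems/`
proof can restate it verbatim over importable declarations). -/
theorem stub_farSector :
    ∀ c : ℝ, 0 < c → ∀ z : ℂ,
      (∑' n : ℕ, (Real.exp (-(c * (n : ℝ) ^ 2)) : ℂ) *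
        ((Literature.NumberTheory.LFunctions.xiTaylorCoeff n : ℂ) / (8 * (n.factorial : ℂ))) *
          z ^ n) = 0 →
      4 / c ≤ ‖z‖ → (10 : ℝ) ^ 6 ≤ ‖z‖ →
      20 ≤ c * ‖z‖ / 4 * Real.log (Real.sqrt ‖z‖ / (2 * Real.pi)) →
      z.re < 0 ∧ |z.im| ≤ 2 * Real.sqrt ‖z‖ := by
  sorry

/-- Registered stub `stub_farReal` (= `Sig.stub_farReal`, spelled out). -/
theorem stub_farReal :
    ∀ c : ℝ, 0 < c → ∀ z : ℂ,
      (∑' n : ℕ, (Real.exp (-(c * (n : ℝ) ^ 2)) : ℂ) *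
        ((Literature.NumberTheory.LFunctions.xiTaylorCoeff n : ℂ) / (8 * (n.factorial : ℂ))) *
          z ^ n) = 0 →
      4 / c ≤ ‖z‖ → (10 : ℝ) ^ 6 ≤ ‖z‖ →
      20 ≤ c * ‖z‖ / 4 * Real.log (Real.sqrt ‖z‖ / (2 * Real.pi)) →
      (z.re < 0 ∧ |z.im| ≤ 2 * Real.sqrt ‖z‖) → z.im = 0 := by
  sorry

/-- Registered stub `stub_window` (= `Sig.stub_window`, spelled out). -/
theorem stub_window :
    ∀ c : ℝ, 0 < c → ∀ z : ℂ,
      (∑' n : ℕ, (Real.exp (-(c * (n : ℝ) ^ 2)) : ℂ) *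
        ((Literature.NumberTheory.LFunctions.xiTaylorCoeff n : ℂ) / (8 * (n.factorial : ℂ))) *
          z ^ n) = 0 →
      4 / c ≤ ‖z‖ →
      (‖z‖ < (10 : ℝ) ^ 6 ∨ c * ‖z‖ / 4 * Real.log (Real.sqrt ‖z‖ / (2 * Real.pi)) < 20) →
      z.im = 0 := by
  sorry

/-! ## Composition (sorry-free) and the skeleton theorem -/

/-- **Composition.** The three stub statements imply the crux
`Summit.RiemannHypothesis.RiemannHypothesis.Theses.AngularHeatFlow.AhfHighReal` BY NAME — case split
on the far-regime predicate `10⁶ ≤ ‖z‖ ∧ 20 ≤ (c‖z‖/4)·log(√‖z‖/(2π))`: in the far regime the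
a-priori sector (stub 1) feeds the graded reality theorem (stub 2); otherwise the window (stub 3). -/
theorem AhfHighReal_of (hS : Sig.stub_farSector) (hF : Sig.stub_farReal) (hW : Sig.stub_window) :
    AhfHighReal := by
  intro c hc z hz hR
  by_cases hfar :
      (10 : ℝ) ^ 6 ≤ ‖z‖ ∧ 20 ≤ c * ‖z‖ / 4 * Real.log (Real.sqrt ‖z‖ / (2 * Real.pi))
  · exact hF c hc z hz hR hfar.1 hfar.2 (hS c hc z hz hR hfar.1 hfar.2)
  · refine hW c hc z hz hR ?_
    rcases not_and_or.mp hfar with h | h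
    · exact Or.inl (lt_of_not_ge h)
    · exact Or.inr (lt_of_not_ge h)

/-- **The skeleton**: the crux BY NAME from the three registered stubs (depends on `sorryAx` only
through `stub_*`). -/
theorem AhfHighReal_proof : AhfHighReal :=
  AhfHighReal_of stub_farSector stub_farReal stub_window

/-! ## Calibration (sorry-free) -/

/-- The registered stubs are literally the `Sig` propositions. -/
example : (Sig.stub_farSector ↔ (∀ c : ℝ, 0 < c → ∀ z : ℂ,
      (∑' n : ℕ, (Real.exp (-(c * (n : ℝ) ^ 2)) : ℂ) *
        ((Literature.NumberTheory.LFunctions.xiTaylorCoeff n : ℂ) / (8 * (n.factorial : ℂ))) *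
          z ^ n) = 0 →
      4 / c ≤ ‖z‖ → (10 : ℝ) ^ 6 ≤ ‖z‖ →
      20 ≤ c * ‖z‖ / 4 * Real.log (Real.sqrt ‖z‖ / (2 * Real.pi)) →
      z.re < 0 ∧ |z.im| ≤ 2 * Real.sqrt ‖z‖)) ∧
    (Sig.stub_farReal ↔ (∀ c : ℝ, 0 < c → ∀ z : ℂ,
      (∑' n : ℕ, (Real.exp (-(c * (n : ℝ) ^ 2)) : ℂ) *
        ((Literature.NumberTheory.LFunctions.xiTaylorCoeff n : ℂ) / (8 * (n.factorial : ℂ))) *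
          z ^ n) = 0 →
      4 / c ≤ ‖z‖ → (10 : ℝ) ^ 6 ≤ ‖z‖ →
      20 ≤ c * ‖z‖ / 4 * Real.log (Real.sqrt ‖z‖ / (2 * Real.pi)) →
      (z.re < 0 ∧ |z.im| ≤ 2 * Real.sqrt ‖z‖) → z.im = 0)) ∧
    (Sig.stub_window ↔ (∀ c : ℝ, 0 < c → ∀ z : ℂ,
      (∑' n : ℕ, (Real.exp (-(c * (n : ℝ) ^ 2)) : ℂ) *
        ((Literature.NumberTheory.LFunctions.xiTaylorCoeff n : ℂ) / (8 * (n.factorial : ℂ))) *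
          z ^ n) = 0 →
      4 / c ≤ ‖z‖ →
      (‖z‖ < (10 : ℝ) ^ 6 ∨ c * ‖z‖ / 4 * Real.log (Real.sqrt ‖z‖ / (2 * Real.pi)) < 20) →
      z.im = 0)) :=
  ⟨Iff.rfl, Iff.rfl, Iff.rfl⟩

/-- Calibration: stubs 2 and 3 are restrictions of the crux (so the cut loses no strength there;
stub 1 is RH-implied and, given the crux, reduces to `T_c G > 0` on `[0, ∞)` from the positivity of
the coefficients — not recorded here), and the crux gives the route's support item `AhfTailFinite`
with `R := 4/c`. -/
example (h : AhfHighReal) : Sig.stub_farReal ∧ Sig.stub_window ∧ AhfTailFinite :=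
  ⟨fun c hc z hz hR _ _ _ => h c hc z hz hR, fun c hc z hz hR _ => h c hc z hz hR,
    fun c hc => ⟨4 / c, fun z hz hR => h c hc z hz hR⟩⟩

end Summit.RiemannHypothesis.RiemannHypothesis.Cruxes.AhfHighReal.Birth
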